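import Mathlib
import Literature.RingTheory.MvPowerSeries.FrobeniusPowerBasis
import Summits.ResolutionOfSingularities.ResolutionOfSingularities.Theorems.WeightedInvariantLocalWeightedDropNCResCurveGenericBranch

/-!
# `LocalWeightedDrop`, NC count game — S-CRV (C-b) layer D: INTEGRALITY DESCENT — a branch `y + a(x)` whose `o`-th power has integral
# distinguished coefficients is itself integral (binomial coefficient + Frobenius, any characteristic)

[OURS · L1 W4.3 · chain w43, engine crux `LocalWeightedDrop` stmt-ResolutionOfSingularities-8899; companion of `…NCResCurveGenericBranch` (layer
K2, p530756); res-type-088 (g8) — the DESCENT half of the finding «the generic-point route (TOT2-LINE v1 §5 (C-b)) closes WITHOUT analytic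
unramifiedness» (STATUS 12:27Z; (C-b) itself is withdrawn in TOT2-LINE v1.1 — this is free-standing algebra); `--supports 8899 --as helper`,
counted 0; definition-free; nothing here is a statement of any manuscript; AI-written (gate-accepted = sorry-free, standard axioms; not refereed).]

SETTING.  `ι : R₀ →+* K` a ring map into a field (model: `k⟦t⟧ ↪ k((t))`, `val_le_one_pow_iff`-type root closure) such that
(ROOT) `x^q ∈ ι(R₀) ⇒ x ∈ ι(R₀)` for `q = p^e`, `p` the exponential characteristic of `K`.  A series over `K` is INTEGRAL when it lies in the
range of `MvPowerSeries.map ι`.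
* `choose_mul_prime_pow_modEq` — Lucas: `C(m·p^e, p^e) ≡ m (mod p)`; `natCast_choose_mul_pow_ne_zero` — so `C(m·p^e, p^e) ≠ 0` in `K` when
  `m ≠ 0` in `K` (exponential characteristic `p`, including `p = 1`).
* `mem_range_map_of_pow_mem` — (ROOT) lifts to series coefficientwise: `a^{p^e}` integral ⇒ `a` integral (`coeff_smul_pow_pow`: the
  `p^e·m`-coefficient of `a^{p^e}` is `(a_m)^{p^e}`).
* **`branch_integral_of_choose_mul_pow_eq`** — if `r_j = C(o, j) · a^{o−j}` for all `j < o` (the conclusion of `distinguished_eq_branch_pow`),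
  every `r_j` is integral, `o = m·p^e` with `m ≠ 0` in `K` and `C(o, p^e)` a unit of `R₀`, then `a` is integral: read `j = o − p^e`.
CONSEQUENCE (the finding, informal): over `A = k⟦u,t,z⟧`, a near-section chain over `C = V(u,z)` that never drops the order forces, at the generic
point `K = k((t))`, `gp(f) = v·P = W·(z + a(u))^o` with `P` distinguished and `gp(r_j)` integral; `distinguished_eq_branch_pow` + this file give `a`
integral, i.e. `f = v·(z + α(u,t))^o` in `A` — no excellence, no clearing of denominators.
-/

set_option linter.dupNamespace false -- mandated namespace of this single-conjunct summit

noncomputable section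

namespace Summit.ResolutionOfSingularities.ResolutionOfSingularities.Theorems

namespace TOT2Curve

open MvPowerSeries

/-! ## Lucas: `C(m·p^e, p^e) ≡ m (mod p)` -/

/-- LUCAS for the pure prime power: `C(m·p^e, p^e) ≡ m (mod p)`. -/
theorem choose_mul_prime_pow_modEq (p : ℕ) [hp : Fact p.Prime] (m : ℕ) : ∀ e : ℕ, (m * p ^ e).choose (p ^ e) ≡ m [MOD p]
  | 0 => by rw [pow_zero, mul_one, Nat.choose_one_right]
  | e + 1 => by
    have h := Choose.choose_modEq_choose_mod_mul_choose_div_nat (n := m * p ^ (e + 1)) (k := p ^ (e + 1)) (p := p)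
    have hp0 : 0 < p := hp.out.pos
    have h1 : m * p ^ (e + 1) % p = 0 := by rw [pow_succ, ← mul_assoc]; exact Nat.mul_mod_left _ _
    have h2 : p ^ (e + 1) % p = 0 := by rw [pow_succ]; exact Nat.mul_mod_left _ _
    have h3 : m * p ^ (e + 1) / p = m * p ^ e := by
      rw [pow_succ, ← mul_assoc, Nat.mul_div_cancel _ hp0]
    have h4 : p ^ (e + 1) / p = p ^ e := by rw [pow_succ, Nat.mul_div_cancel _ hp0]
    rw [h1, h2, h3, h4, Nat.choose_zero_right, one_mul] at h
    exact h.trans (choose_mul_prime_pow_modEq p m e)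

/-- In a field of exponential characteristic `p` (so `p = 1` in characteristic `0`): `C(m·p^e, p^e) ≠ 0` whenever `m ≠ 0` in `K`. -/
theorem natCast_choose_mul_pow_ne_zero {K : Type} [Field K] (p : ℕ) [hK : ExpChar K p] {m : ℕ} (hm : (m : K) ≠ 0) (e : ℕ) :
    (((m * p ^ e).choose (p ^ e) : ℕ) : K) ≠ 0 := by
  cases hK with
  | zero => rwa [one_pow, mul_one, Nat.choose_one_right]
  | prime hprime =>
    haveI : Fact p.Prime := ⟨hprime⟩
    intro h0
    apply hm
    have hmod := choose_mul_prime_pow_modEq p m e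
    rw [CharP.cast_eq_zero_iff K p] at h0 ⊢
    exact (hmod.dvd_iff (dvd_refl p)).mp h0

/-! ## Root closure lifts to series coefficientwise -/

/-- (ROOT) LIFTS TO SERIES: if `x^{p^e} ∈ ι(R₀) ⇒ x ∈ ι(R₀)` in `K` (exponential characteristic `p`), then a series `a` over `K` whose `p^e`-th power
has coefficients in `ι(R₀)` has itself coefficients in `ι(R₀)` — by `(a^{p^e})_{p^e m} = (a_m)^{p^e}`. -/
theorem mem_range_map_of_pow_mem {R₀ K : Type} [CommRing R₀] [Field K] (p : ℕ) [ExpChar K p] (ι : R₀ →+* K) (e : ℕ)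
    (hroot : ∀ x : K, x ^ p ^ e ∈ Set.range ι → x ∈ Set.range ι) {σ : Type} (a : MvPowerSeries σ K)
    (ha : a ^ p ^ e ∈ Set.range (MvPowerSeries.map (σ := σ) ι)) : a ∈ Set.range (MvPowerSeries.map (σ := σ) ι) := by
  classical
  obtain ⟨b, hb⟩ := ha
  have hcoeff : ∀ m : σ →₀ ℕ, coeff m a ∈ Set.range ι := by
    intro m
    apply hroot
    refine ⟨coeff (p ^ e • m) b, ?_⟩
    rw [← Literature.RingTheory.MvPowerSeries.coeff_smul_pow_pow p a e m, ← hb, coeff_map]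
  choose c hc using hcoeff
  refine ⟨fun m => c m, ?_⟩
  ext m
  rw [coeff_map]
  exact hc m

/-! ## The descent -/

/-- **INTEGRALITY DESCENT.**  Let `o = m · p^e` with `m ≠ 0` in `K` (exponential characteristic `p`; in characteristic `0` take `e = 0`), `ι : R₀ → K`
with the root property (ROOT) for `p^e` and `C(o, p^e)` a unit of `R₀`.  If `r_j = C(o, j) · a^{o−j}` for all `j < o` (the conclusion of
`distinguished_eq_branch_pow`) and every `r_j` is integral, then `a` is integral. -/
theorem branch_integral_of_choose_mul_pow_eq {R₀ K : Type} [CommRing R₀] [Field K] (p : ℕ) [ExpChar K p] (ι : R₀ →+* K) (e m : ℕ)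
    (hm : (m : K) ≠ 0) (hroot : ∀ x : K, x ^ p ^ e ∈ Set.range ι → x ∈ Set.range ι)
    (hunit : IsUnit (((m * p ^ e).choose (p ^ e) : ℕ) : R₀)) {σ : Type}
    (r : Fin (m * p ^ e) → MvPowerSeries σ K) (hr : ∀ j, r j ∈ Set.range (MvPowerSeries.map (σ := σ) ι)) (a : MvPowerSeries σ K)
    (hra : ∀ j : Fin (m * p ^ e), r j = ((m * p ^ e).choose (j : ℕ) : MvPowerSeries σ K) * a ^ (m * p ^ e - (j : ℕ))) :
    a ∈ Set.range (MvPowerSeries.map (σ := σ) ι) := by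
  classical
  have hp : 0 < p ^ e := pow_pos (Nat.pos_of_ne_zero (expChar_ne_zero K p)) e
  have hm0 : 0 < m := Nat.pos_of_ne_zero (fun h => hm (by rw [h, Nat.cast_zero]))
  have hle : p ^ e ≤ m * p ^ e := Nat.le_mul_of_pos_left _ hm0
  have hlt : m * p ^ e - p ^ e < m * p ^ e := Nat.sub_lt (Nat.mul_pos hm0 hp) hp
  have hsub : m * p ^ e - (m * p ^ e - p ^ e) = p ^ e := by omega
  -- read the relation at `j₀ = o - p^e`: `r_{j₀} = C(o, p^e) · a^{p^e}`
  have h1 : r ⟨m * p ^ e - p ^ e, hlt⟩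
      = ((m * p ^ e).choose (p ^ e) : MvPowerSeries σ K) * a ^ p ^ e := by
    rw [hra ⟨m * p ^ e - p ^ e, hlt⟩]
    simp only [hsub, Nat.choose_symm hle]
  -- `a^{p^e} = ι(u⁻¹) · r_{j₀}` is integral
  obtain ⟨u, hu⟩ := hunit
  obtain ⟨b, hb⟩ := hr ⟨m * p ^ e - p ^ e, hlt⟩
  have hcu : MvPowerSeries.C (ι (↑u⁻¹ : R₀)) * (((m * p ^ e).choose (p ^ e) : ℕ) : MvPowerSeries σ K) = 1 := by
    rw [← map_natCast (MvPowerSeries.C (σ := σ) (R := K)), ← map_mul, ← map_natCast ι, ← map_mul, ← hu,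
      Units.inv_mul, map_one, map_one]
  have hkey : a ^ p ^ e = MvPowerSeries.map (σ := σ) ι (MvPowerSeries.C ((↑u⁻¹ : R₀)) * b) := by
    rw [map_mul, hb, h1, MvPowerSeries.map_C, ← mul_assoc, hcu, one_mul]
  exact mem_range_map_of_pow_mem p ι e hroot a ⟨_, hkey.symm⟩

open Literature.AlgebraicGeometry.Resolution in
/-- **PERSISTENT BRANCH POWERS ARE INTEGRAL** (composition with `distinguished_eq_branch_pow`, layer K2).  If a unit multiple of the
distinguished polynomial `y^o + Σ_{j<o} r_j(x) y^j` with INTEGRAL coefficients `r_j` equals `W · (y + a(x))^o` over `K`, `o = m·p^e` with `m ≠ 0`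
in `K`, (ROOT) holds for `p^e` and `C(o, p^e)` is a unit of `R₀`, then the branch `a` is integral. -/
theorem branch_integral_of_distinguished_eq_branch_pow {R₀ K : Type} [CommRing R₀] [Field K] (p : ℕ) [ExpChar K p] (ι : R₀ →+* K)
    (e m : ℕ) (hm : (m : K) ≠ 0) (hroot : ∀ x : K, x ^ p ^ e ∈ Set.range ι → x ∈ Set.range ι)
    (hunit : IsUnit (((m * p ^ e).choose (p ^ e) : ℕ) : R₀)) (v W : MvPowerSeries (Fin 2) K) (hv : constantCoeff v ≠ 0)
    (r : Fin (m * p ^ e) → MvPowerSeries (Fin 1) K) (hr : ∀ j, r j ∈ Set.range (MvPowerSeries.map (σ := Fin 1) ι))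
    (a : MvPowerSeries (Fin 1) K) (ha : constantCoeff a = 0)
    (heq : v * (X (Fin.last 1) ^ (m * p ^ e)
        + ∑ j : Fin (m * p ^ e), rename (Fin.succAboveEmb (Fin.last 1)) (r j) * X (Fin.last 1) ^ (j : ℕ)) =
      W * (X (Fin.last 1) + rename (Fin.succAboveEmb (Fin.last 1)) a) ^ (m * p ^ e)) :
    a ∈ Set.range (MvPowerSeries.map (σ := Fin 1) ι) :=
  branch_integral_of_choose_mul_pow_eq p ι e m hm hroot hunit r hr a (distinguished_eq_branch_pow v W hv r a ha heq)

/-! ## The model instance `k⟦t⟧ ⊂ k((t))` -/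

/-- (ROOT) for power series inside Laurent series: if `x^q` (`q ≥ 1`) is a power series, so is `x` (valuation). -/
theorem laurentSeries_root_closed (k : Type) [Field k] (q : ℕ) (hq : 0 < q) (x : LaurentSeries k)
    (hx : x ^ q ∈ Set.range (HahnSeries.ofPowerSeries ℤ k)) : x ∈ Set.range (HahnSeries.ofPowerSeries ℤ k) := by
  obtain ⟨F, hF⟩ := hx
  have hv : Valued.v (x ^ q) ≤ (1 : WithZero (Multiplicative ℤ)) := by
    rw [LaurentSeries.val_le_one_iff_eq_coe]
    exact ⟨F, hF⟩
  rw [map_pow] at hv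
  have hv1 : Valued.v x ≤ (1 : WithZero (Multiplicative ℤ)) := by
    by_contra h
    exact absurd hv (not_le.mpr (one_lt_pow₀ (not_le.mp h) hq.ne'))
  obtain ⟨G, hG⟩ := (LaurentSeries.val_le_one_iff_eq_coe k x).mp hv1
  exact ⟨G, hG⟩

end TOT2Curve

end Summit.ResolutionOfSingularities.ResolutionOfSingularities.Theorems

end
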